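import Mathlib
import Summits.ResolutionOfSingularities.ResolutionOfSingularities.Theorems.WeightedInvariantLocalWeightedDropNCResSurfGraphCurveData
import Summits.ResolutionOfSingularities.ResolutionOfSingularities.Theorems.WeightedInvariantLocalWeightedDropNCResSurfGraphShadow

/-!
# `WeightedInvariant.LocalWeightedDrop`: NC-resolution settings for the TOT₂ line — GRAPH SURFACES, part 24: UNIT-MONOMIAL TRACES THROUGH THE MOVES

Crux item stmt-ResolutionOfSingularities-8899 `LocalWeightedDrop` (route `ResolutionOfSingularities/WeightedInvariant`), ENGINE skeleton v34/v35, residual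
`stub_wildWideApexFourStartsWon`; res-L1-w43-strat-1's line `directrix-cut` v3f, piece PL₃, sub-skeleton `pl3_split_v1` (7519a9009475ab47), stub
`stub_apexPlaneSurfaceThree` = the SURFACE sub-case `ApexPlaneSurfaceExit`, reduced (…NCResSurfGraphRegime, p557720) to the loop `SurfLoop k m`.
Design memo `L/res-L1-w43-stub-4/g6/SURFLOOP-DESIGN.md`.  [OURS · L1 W4.3 · chain w43 · seat res-L1-w43-stub-4 gen 6; def-free, on parts 1–19 and 22
(…NCResSurfGraph*), res-L1-w43-stub-1's S-SET and res-L1-w43-lead-1's boundary bookkeeping (…NCResRegimeTransport); the count game is the programme's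
own; nothing here is a statement of any manuscript; AI-produced, gate-checked, weaker than expert review.]

The algebra of the monomial endgame (memo §3): in a MONOMIAL loop state (`SurfDatum.IsMonomial`: every off-base boundary trace is `0` or
`unit · x₀^p x₁^q`) the point move read at `a` sends `unit·x₀^p x₁^q ↦ unit·x₀^{p+q−1} x₁^{q'}` (`q' = q` on the second axis `μ = 0`, `q' = 0` off it;
`pointSucc_ψ_monomial`), the curve move sends `unit·x₀^p x₁^q ↦ unit·x₀^{p−1} x₁^q` (`curveSucc_ψ_monomial`), zero traces stay zero, and a letter DIES
(`c_l ≠ 0`) exactly when its trace is `x₀·unit`, or `x₁·unit` off the second axis (`point_answer_eq_zero_iff`, `curve_answer_eq_zero_iff`).  Also the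
swapped reading of a monomial state (`IsMonomial.swap`, `expMultiset_swap`) and the linear coefficients of unit monomials.
-/

set_option linter.dupNamespace false -- mandated namespace of this single-conjunct summit

noncomputable section

namespace Summit.ResolutionOfSingularities.ResolutionOfSingularities.Theorems

namespace TameFourTupleDrop

namespace GraphSurf

namespace SurfDatum

open MvPowerSeries Literature.AlgebraicGeometry.Resolution

variable {k : Type} [Field k] {m : ℕ}

/-- Constant term of a unit monomial. -/
theorem constantCoeff_unit_monomial (u : MvPowerSeries (Fin 2) k) (p q : ℕ) :
    constantCoeff (u * X 0 ^ p * X 1 ^ q) = if p = 0 ∧ q = 0 then constantCoeff u else 0 := by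
  rw [map_mul, map_mul, map_pow, map_pow, constantCoeff_X, constantCoeff_X]
  by_cases hp : p = 0
  · by_cases hq : q = 0
    · simp [hp, hq]
    · simp [hp, hq, zero_pow hq]
  · simp [hp, zero_pow hp]

/-- A unit monomial with zero constant term has a positive exponent. -/
theorem exps_ne_zero_of_constantCoeff {u : MvPowerSeries (Fin 2) k} (hu : constantCoeff u ≠ 0) {p q : ℕ}
    (h : constantCoeff (u * X 0 ^ p * X 1 ^ q) = 0) : ¬ (p = 0 ∧ q = 0) := by
  rw [constantCoeff_unit_monomial] at h
  intro hpq
  rw [if_pos hpq] at h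
  exact hu h

/-- The `x₀`-linear coefficient of a unit monomial with positive exponent. -/
theorem coeff_single_zero_unit_monomial (u : MvPowerSeries (Fin 2) k) {p q : ℕ} (hpq : ¬ (p = 0 ∧ q = 0)) :
    coeff (Finsupp.single 0 1) (u * X 0 ^ p * X 1 ^ q) = if p = 1 ∧ q = 0 then constantCoeff u else 0 := by
  rw [mul_assoc, X_pow_eq, X_pow_eq, monomial_mul_monomial, one_mul, coeff_mul_monomial]
  by_cases h : p = 1 ∧ q = 0
  · rw [if_pos h, h.1, h.2, Finsupp.single_zero, add_zero, if_pos le_rfl, tsub_self, mul_one, coeff_zero_eq_constantCoeff]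
  · rw [if_neg h, if_neg]
    intro hle
    have h0 := hle 0
    have h1 := hle 1
    simp only [Finsupp.coe_add, Pi.add_apply, Finsupp.single_eq_same, ne_eq, zero_ne_one, not_false_eq_true,
      Finsupp.single_eq_of_ne, add_zero, zero_add, one_ne_zero] at h0 h1
    omega

/-- The `x₁`-linear coefficient of a unit monomial with positive exponent. -/
theorem coeff_single_one_unit_monomial (u : MvPowerSeries (Fin 2) k) {p q : ℕ} (hpq : ¬ (p = 0 ∧ q = 0)) :
    coeff (Finsupp.single 1 1) (u * X 0 ^ p * X 1 ^ q) = if p = 0 ∧ q = 1 then constantCoeff u else 0 := by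
  rw [mul_assoc, X_pow_eq, X_pow_eq, monomial_mul_monomial, one_mul, coeff_mul_monomial]
  by_cases h : p = 0 ∧ q = 1
  · rw [if_pos h, h.1, h.2, Finsupp.single_zero, zero_add, if_pos le_rfl, tsub_self, mul_one, coeff_zero_eq_constantCoeff]
  · rw [if_neg h, if_neg]
    intro hle
    have h0 := hle 0
    have h1 := hle 1
    simp only [Finsupp.coe_add, Pi.add_apply, Finsupp.single_eq_same, ne_eq, zero_ne_one, not_false_eq_true,
      Finsupp.single_eq_of_ne, add_zero, zero_add, one_ne_zero] at h0 h1
    omega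

/-- The swap of a unit monomial. -/
theorem subst_sw_unit_monomial (u : MvPowerSeries (Fin 2) k) (p q : ℕ) :
    subst (![X 1, X 0] : Fin 2 → MvPowerSeries (Fin 2) k) (u * X 0 ^ p * X 1 ^ q) =
      subst (![X 1, X 0] : Fin 2 → MvPowerSeries (Fin 2) k) u * X 0 ^ q * X 1 ^ p := by
  rw [← coe_substAlgHom TOT2Curve.hasSubst_swap, map_mul, map_mul, map_pow, map_pow, coe_substAlgHom, subst_X TOT2Curve.hasSubst_swap, subst_X TOT2Curve.hasSubst_swap]
  simp only [Matrix.cons_val_zero, Matrix.cons_val_one]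
  ring

/-- **MONOMIAL STATES READ THE OTHER WAY ROUND** are monomial with the exponents exchanged. -/
theorem IsMonomial.swap {σ : SurfDatum k m} {e : Fin (m + 1) → ℕ × ℕ} (h : σ.IsMonomial e) :
    σ.swap.IsMonomial fun l => ((e l).2, (e l).1) := by
  intro l hl
  rw [off_swap] at hl
  rcases h l hl with h0 | ⟨u, hu, he⟩
  · left
    rw [swap_ψ, h0, ← coe_substAlgHom TOT2Curve.hasSubst_swap, map_zero]
  · right
    refine ⟨subst (![X 1, X 0] : Fin 2 → MvPowerSeries (Fin 2) k) u, by rwa [constantCoeff_swap], ?_⟩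
    rw [swap_ψ, he, subst_sw_unit_monomial]

open Classical in
/-- The exponent multiset of the swapped reading. -/
theorem expMultiset_swap (σ : SurfDatum k m) (e : Fin (m + 1) → ℕ × ℕ) :
    σ.swap.expMultiset (fun l => ((e l).2, (e l).1)) = (σ.expMultiset e).map Prod.swap := by
  rw [expMultiset, expMultiset, off_swap, Multiset.map_map]
  have hS : (σ.off.filter fun l => σ.swap.ψ l ≠ 0) = σ.off.filter fun l => σ.ψ l ≠ 0 :=
    Finset.filter_congr fun l _ => by rw [swap_ψ, ne_eq, subst_sw_eq_zero_iff]
  rw [hS]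
  rfl

/-! ### Through the point move (reading at `a`) -/

/-- A ZERO TRACE STAYS ZERO through the point move (for a letter through the answer). -/
theorem pointSucc_ψ_eq_zero {σ : SurfDatum k m} {c : Fin (m + 1) → k} (G : MvPowerSeries (Fin (m + 1 + 1)) k) {l : Fin (m + 1)}
    (hl : l ≠ σ.a) (h0 : σ.ψ l = 0) (hcl : c l = 0) : (σ.pointSucc c G).ψ (Fin.predAbove σ.a l.succ) = 0 := by
  have h := subst_cb_ψ G hl (c := c) (by rw [h0, map_zero])
  rw [h0, hcl, map_zero, zero_mul, add_zero, ← coe_substAlgHom (hasSubst_cb _ _), map_zero] at h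
  exact (mul_eq_zero.mp h.symm).resolve_left (FormalCoordChange.X_ne_zero' _)

open Classical in
/-- **A UNIT-MONOMIAL TRACE THROUGH THE POINT MOVE** (letter through the answer, reading at `a`, `(λ, μ) = (c_a, c_b)`):
`unit · x₀^p x₁^q ↦ unit · x₀^{p+q−1} x₁^{q'}`, `q' = q` if `μ = 0` and `q' = 0` otherwise. -/
theorem pointSucc_ψ_monomial {σ : SurfDatum k m} {c : Fin (m + 1) → k} (hca : c σ.a ≠ 0) (G : MvPowerSeries (Fin (m + 1 + 1)) k)
    {l : Fin (m + 1)} (hl : l ≠ σ.a) (hcl : c l = 0) {u : MvPowerSeries (Fin 2) k} (hu : constantCoeff u ≠ 0) {p q : ℕ}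
    (hpq : ¬ (p = 0 ∧ q = 0)) (hψ : σ.ψ l = u * X 0 ^ p * X 1 ^ q) :
    ∃ u' : MvPowerSeries (Fin 2) k, constantCoeff u' ≠ 0 ∧
      (σ.pointSucc c G).ψ (Fin.predAbove σ.a l.succ) = u' * X 0 ^ (p + q - 1) * X 1 ^ (if c σ.b = 0 then q else 0) := by
  have hS := hasSubst_cb (k := k) (c σ.a) (c σ.b)
  have h0 : constantCoeff (σ.ψ l) = 0 := by
    rw [hψ, constantCoeff_unit_monomial, if_neg hpq]
  have h := subst_cb_ψ G hl (c := c) h0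
  rw [hcl, map_zero, zero_mul, add_zero, hψ, ← coe_substAlgHom hS, map_mul, map_mul, map_pow, map_pow, coe_substAlgHom,
    subst_X hS, subst_X hS] at h
  simp only [Matrix.cons_val_zero, Matrix.cons_val_one] at h
  have hu' : constantCoeff (subst (![C (c σ.a) * X 0, X 0 * (C (c σ.b) + X 1)] : Fin 2 → MvPowerSeries (Fin 2) k) u) ≠ 0 := by
    rwa [TOT2E1.constantCoeff_subst_of_constantCoeff_zero _ (fun t => by fin_cases t <;> simp [constantCoeff_X]) u]
  have hX : (X 0 : MvPowerSeries (Fin 2) k) ^ p * X 0 ^ q = X 0 * X 0 ^ (p + q - 1) := by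
    rw [← pow_add, ← pow_succ']
    congr 1
    omega
  -- `x₀ · ψ' = x₀ · (unit · x₀^{p+q-1} · (μ + x₁)^q)`
  have key : (σ.pointSucc c G).ψ (Fin.predAbove σ.a l.succ) =
      subst (![C (c σ.a) * X 0, X 0 * (C (c σ.b) + X 1)] : Fin 2 → MvPowerSeries (Fin 2) k) u * C (c σ.a ^ p) *
        (C (c σ.b) + X 1) ^ q * X 0 ^ (p + q - 1) := by
    refine mul_left_cancel₀ (FormalCoordChange.X_ne_zero' (0 : Fin 2)) ?_
    rw [← h, map_pow, mul_pow, mul_pow]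
    rw [show (X 0 : MvPowerSeries (Fin 2) k) * (subst (![C (c σ.a) * X 0, X 0 * (C (c σ.b) + X 1)] : Fin 2 → MvPowerSeries (Fin 2) k) u *
        C (c σ.a) ^ p * (C (c σ.b) + X 1) ^ q * X 0 ^ (p + q - 1)) =
        subst (![C (c σ.a) * X 0, X 0 * (C (c σ.b) + X 1)] : Fin 2 → MvPowerSeries (Fin 2) k) u * C (c σ.a) ^ p *
        (C (c σ.b) + X 1) ^ q * (X 0 ^ p * X 0 ^ q) by rw [hX]; ring]
    ring
  by_cases hμ : c σ.b = 0
  · refine ⟨subst (![C (c σ.a) * X 0, X 0 * (C (c σ.b) + X 1)] : Fin 2 → MvPowerSeries (Fin 2) k) u * C (c σ.a ^ p), ?_, ?_⟩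
    · rw [map_mul, constantCoeff_C]
      exact mul_ne_zero hu' (pow_ne_zero _ hca)
    · rw [key, if_pos hμ, hμ, map_zero, zero_add]
      ring
  · refine ⟨subst (![C (c σ.a) * X 0, X 0 * (C (c σ.b) + X 1)] : Fin 2 → MvPowerSeries (Fin 2) k) u * C (c σ.a ^ p) *
      (C (c σ.b) + X 1) ^ q, ?_, ?_⟩
    · simp only [map_mul, map_pow, map_add, constantCoeff_C, constantCoeff_X, add_zero]
      exact mul_ne_zero (mul_ne_zero hu' (pow_ne_zero _ hca)) (pow_ne_zero _ hμ)
    · rw [key, if_neg hμ, pow_zero, mul_one]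

/-- **DEATH AT THE POINT MOVE** (reading at `a`): a unit-monomial letter passes through the answer iff it is not `x₀ · unit`, and not `x₁ · unit` unless
`μ = 0`. -/
theorem point_answer_eq_zero_iff {σ : SurfDatum k m} {c : Fin (m + 1) → k}
    (hc : c = c σ.a • tangentL σ.a σ.b σ.ψ + c σ.b • tangentR σ.a σ.b σ.ψ) (hca : c σ.a ≠ 0)
    {l : Fin (m + 1)} (hl : l ∈ σ.off) {u : MvPowerSeries (Fin 2) k} (hu : constantCoeff u ≠ 0) {p q : ℕ}
    (hpq : ¬ (p = 0 ∧ q = 0)) (hψ : σ.ψ l = u * X 0 ^ p * X 1 ^ q) :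
    c l = 0 ↔ ¬ (p = 1 ∧ q = 0) ∧ (c σ.b = 0 ∨ ¬ (p = 0 ∧ q = 1)) := by
  rw [answer_apply hc ((mem_off_iff σ l).mp hl).2, hψ, coeff_single_zero_unit_monomial u hpq, coeff_single_one_unit_monomial u hpq]
  by_cases h10 : p = 1 ∧ q = 0
  · have h01 : ¬ (p = 0 ∧ q = 1) := by omega
    rw [if_pos h10, if_neg h01, mul_zero, add_zero]
    constructor
    · intro h
      exact absurd h (mul_ne_zero hca hu)
    · rintro ⟨h, -⟩
      exact absurd h10 h
  · rw [if_neg h10, mul_zero, zero_add]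
    by_cases h01 : p = 0 ∧ q = 1
    · rw [if_pos h01]
      constructor
      · intro h
        refine ⟨h10, Or.inl ?_⟩
        rcases mul_eq_zero.mp h with h | h
        · exact h
        · exact absurd h hu
      · rintro ⟨-, h | h⟩
        · rw [h, zero_mul]
        · exact absurd h01 h
    · rw [if_neg h01, mul_zero]
      simp [h10, h01]

/-- A zero-trace letter passes through every tangent-plane answer. -/
theorem point_answer_eq_zero_of_ψ_eq_zero {σ : SurfDatum k m} {c : Fin (m + 1) → k}
    (hc : c = c σ.a • tangentL σ.a σ.b σ.ψ + c σ.b • tangentR σ.a σ.b σ.ψ) {l : Fin (m + 1)} (hl : l ∈ σ.off) (h0 : σ.ψ l = 0) :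
    c l = 0 := by
  rw [answer_apply hc ((mem_off_iff σ l).mp hl).2, h0, map_zero, map_zero, mul_zero, mul_zero, add_zero]

/-! ### Through the curve move -/

/-- A ZERO TRACE STAYS ZERO through the curve move. -/
theorem curveSucc_ψ_eq_zero {σ : SurfDatum k m} {c : Fin (m + 1) → k} (G : MvPowerSeries (Fin (m + 1 + 1)) k) {l : Fin (m + 1)}
    (hl : l ∈ σ.off) (h0 : σ.ψ l = 0) (hcl : c l = 0) : (σ.curveSucc c G).ψ (Fin.predAbove σ.a l.succ) = 0 := by
  obtain ⟨hlE, hlab⟩ := (mem_off_iff σ l).mp hl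
  have h := subst_ccb_ψ G (c := c) (fun h' => hlab (Or.inl h')) hlE (by rw [h0]; exact dvd_zero _)
  rw [h0, hcl, map_zero, zero_mul, add_zero, ← coe_substAlgHom (hasSubst_ccb _), map_zero] at h
  exact (mul_eq_zero.mp h.symm).resolve_left (FormalCoordChange.X_ne_zero' _)

/-- **A UNIT-MONOMIAL TRACE THROUGH THE CURVE MOVE** (`p ≥ 1`): `unit · x₀^p x₁^q ↦ unit · x₀^{p−1} x₁^q`. -/
theorem curveSucc_ψ_monomial {σ : SurfDatum k m} {c : Fin (m + 1) → k} (hca : c σ.a ≠ 0) (G : MvPowerSeries (Fin (m + 1 + 1)) k)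
    {l : Fin (m + 1)} (hl : l ∈ σ.off) (hcl : c l = 0) {u : MvPowerSeries (Fin 2) k} (hu : constantCoeff u ≠ 0) {p q : ℕ}
    (hp : 1 ≤ p) (hψ : σ.ψ l = u * X 0 ^ p * X 1 ^ q) :
    ∃ u' : MvPowerSeries (Fin 2) k, constantCoeff u' ≠ 0 ∧
      (σ.curveSucc c G).ψ (Fin.predAbove σ.a l.succ) = u' * X 0 ^ (p - 1) * X 1 ^ q := by
  obtain ⟨hlE, hlab⟩ := (mem_off_iff σ l).mp hl
  have hS := hasSubst_ccb (k := k) (c σ.a)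
  have hX : (X 0 : MvPowerSeries (Fin 2) k) ^ p = X 0 * X 0 ^ (p - 1) := by
    rw [← pow_succ', Nat.sub_add_cancel hp]
  have hdiv : (X 0 : MvPowerSeries (Fin 2) k) ∣ σ.ψ l := ⟨u * X 0 ^ (p - 1) * X 1 ^ q, by rw [hψ, hX]; ring⟩
  have h := subst_ccb_ψ G (c := c) (fun h' => hlab (Or.inl h')) hlE hdiv
  rw [hcl, map_zero, zero_mul, add_zero, hψ, ← coe_substAlgHom hS, map_mul, map_mul, map_pow, map_pow, coe_substAlgHom,
    subst_X hS, subst_X hS] at h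
  simp only [Matrix.cons_val_zero, Matrix.cons_val_one] at h
  have hu' : constantCoeff (subst (![C (c σ.a) * X 0, X 1] : Fin 2 → MvPowerSeries (Fin 2) k) u) ≠ 0 := by
    rwa [TOT2E1.constantCoeff_subst_of_constantCoeff_zero _ (fun t => by fin_cases t <;> simp [constantCoeff_X]) u]
  refine ⟨subst (![C (c σ.a) * X 0, X 1] : Fin 2 → MvPowerSeries (Fin 2) k) u * C (c σ.a ^ p), ?_, ?_⟩
  · rw [map_mul, constantCoeff_C]
    exact mul_ne_zero hu' (pow_ne_zero _ hca)
  · refine mul_left_cancel₀ (FormalCoordChange.X_ne_zero' (0 : Fin 2)) ?_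
    rw [← h, map_pow, mul_pow, hX]
    ring

/-- **DEATH AT THE CURVE MOVE**: a unit-monomial boundary letter passes through the near point iff it is not `x₀ · unit`. -/
theorem curve_answer_eq_zero_iff {σ : SurfDatum k m} {c : Fin (m + 1) → k}
    (hc : c = c σ.a • tangentL σ.a σ.b (fun j => if j ∈ σ.δ.E then σ.ψ j else 0)) (hca : c σ.a ≠ 0)
    {l : Fin (m + 1)} (hl : l ∈ σ.off) {u : MvPowerSeries (Fin 2) k} (hu : constantCoeff u ≠ 0) {p q : ℕ}
    (hpq : ¬ (p = 0 ∧ q = 0)) (hψ : σ.ψ l = u * X 0 ^ p * X 1 ^ q) :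
    c l = 0 ↔ ¬ (p = 1 ∧ q = 0) := by
  obtain ⟨hlE, hlab⟩ := (mem_off_iff σ l).mp hl
  rw [(curve_answer_apply hc).1 l hlE hlab, hψ, coeff_single_zero_unit_monomial u hpq]
  by_cases h10 : p = 1 ∧ q = 0
  · rw [if_pos h10]
    constructor
    · intro h
      exact absurd h (mul_ne_zero hca hu)
    · intro h
      exact absurd h10 h
  · rw [if_neg h10, mul_zero]
    simp [h10]

/-- A zero-trace letter passes through the near point of the curve move. -/
theorem curve_answer_eq_zero_of_ψ_eq_zero {σ : SurfDatum k m} {c : Fin (m + 1) → k}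
    (hc : c = c σ.a • tangentL σ.a σ.b (fun j => if j ∈ σ.δ.E then σ.ψ j else 0)) {l : Fin (m + 1)} (hl : l ∈ σ.off)
    (h0 : σ.ψ l = 0) : c l = 0 := by
  obtain ⟨hlE, hlab⟩ := (mem_off_iff σ l).mp hl
  rw [(curve_answer_apply hc).1 l hlE hlab, h0, map_zero, mul_zero]


end SurfDatum

end GraphSurf

end TameFourTupleDrop

end Summit.ResolutionOfSingularities.ResolutionOfSingularities.Theorems

end
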